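import Summits.ValiantsHypothesis.ValiantsHypothesis.Theorems.DefinabilityGapPivotCrowded
import Summits.ValiantsHypothesis.ValiantsHypothesis.Theorems.DefinabilityGapPivotPhaseA
import HarnessLib

/-!
# Definability gap, ROAD P: Phase A for good lines — few bad lines exist (N1 v2 (b), assembled)

Union of the good-line Bernstein bounds (`DefinabilityGapPivotGoodLines`) over all
`(curve, line)` pairs, plugged into the deterministic interface of `DefinabilityGapPivotCrowded`
and the probabilistic method of `DefinabilityGapPivotPhaseA`:

* `sum_card_coCurves_lightCols_le` / `_lightRows_le` — the light incidence of a line is `≤ m M`;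
* `weight_exists_rowOver_le` / `weight_exists_colOver_le` — under a product law with point
  weights `≤ p`, the assignments overloading SOME light row (column) of SOME curve of `T`
  (light kill sum `≥ p m M + t`) weigh at most `#T · m · exp(−t²/(2(2pmM + 2t/3)))`
  (`#T · m · exp(−t²/(2(pmM + t/3)))`);
* **`exists_adm_fewBadLines`** — PHASE A FOR GOOD LINES: if every admissible set has at least
  `1/p` rows, the budget `2 (L + p m M + t) ≤ m` holds and the two union bounds sum to `< 1`,
  there is an admissible row assignment under which, for every pivot column `s₀` and every
  curve `c ∈ T`, `M · L · #badRows ≤ 2 (#T − 1)` and `M · L · #badCols ≤ 2 (#T − 1)`.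

With `M = m/8`, `L = m/4`, `p = 8/(5m)`, `t = m/20`, `#T ≤ 4m² + 5` this gives `O(1)` bad lines per
curve for all large `m` (PLAN-N1-v2 (b)); the crowded-line / pivot-column part (c) and the
collision stages (d) are separate.
-/

namespace Summit.ValiantsHypothesis.ValiantsHypothesis.Theorems.DefinabilityGapPivotGoodUnion

open Finset Real
open Literature.Computability.AlgebraicComplexity Literature.Computability.MetaComplexity
open Literature.Probability.Moments
open Summit.ValiantsHypothesis.ValiantsHypothesis.Theorems.DefinabilityGapAffineRung
open Summit.ValiantsHypothesis.ValiantsHypothesis.Theorems.DefinabilityGapPivotCertificate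
open Summit.ValiantsHypothesis.ValiantsHypothesis.Theorems.DefinabilityGapPivotLive
open Summit.ValiantsHypothesis.ValiantsHypothesis.Theorems.DefinabilityGapPivotLiveWeak
open Summit.ValiantsHypothesis.ValiantsHypothesis.Theorems.DefinabilityGapPivotLiveBad
open Summit.ValiantsHypothesis.ValiantsHypothesis.Theorems.DefinabilityGapPivotAdmissible
open Summit.ValiantsHypothesis.ValiantsHypothesis.Theorems.DefinabilityGapPivotRandom
open Summit.ValiantsHypothesis.ValiantsHypothesis.Theorems.DefinabilityGapPivotGoodLines
open Summit.ValiantsHypothesis.ValiantsHypothesis.Theorems.DefinabilityGapPivotCrowded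
open Summit.ValiantsHypothesis.ValiantsHypothesis.Theorems.DefinabilityGapPivotPhaseA

variable {m : ℕ}

/-! ## 1. Light incidence of a line -/

/-- The light positions of a row carry fewer than `M` co-curves each: light incidence `≤ m M`.
[this file] -/
theorem sum_card_coCurves_lightCols_le (T : Finset (Fin 3 → Fin (qOf m)))
    (c : Fin 3 → Fin (qOf m)) (M : ℕ) (i : Fin m) :
    ∑ j ∈ lightCols T c M i, ((coCurves T c (i, j)).card : ℝ) ≤ (m : ℝ) * M := by
  have h1 : ∑ j ∈ lightCols T c M i, ((coCurves T c (i, j)).card : ℝ) ≤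
      ∑ j ∈ lightCols T c M i, (M : ℝ) :=
    Finset.sum_le_sum fun j hj => by exact_mod_cast (mem_lightCols.mp hj).le
  have h2 : ((lightCols T c M i).card : ℝ) ≤ m := by
    have := Finset.card_le_univ (lightCols T c M i)
    rw [Fintype.card_fin] at this
    exact_mod_cast this
  rw [Finset.sum_const, nsmul_eq_mul] at h1
  have hM : (0 : ℝ) ≤ M := Nat.cast_nonneg M
  nlinarith

/-- The light positions of a column carry fewer than `M` co-curves each: light incidence
`≤ m M`. [this file] -/
theorem sum_card_coCurves_lightRows_le (T : Finset (Fin 3 → Fin (qOf m)))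
    (c : Fin 3 → Fin (qOf m)) (M : ℕ) (j : Fin m) :
    ∑ i ∈ lightRows T c M j, ((coCurves T c (i, j)).card : ℝ) ≤ (m : ℝ) * M := by
  have h1 : ∑ i ∈ lightRows T c M j, ((coCurves T c (i, j)).card : ℝ) ≤
      ∑ i ∈ lightRows T c M j, (M : ℝ) :=
    Finset.sum_le_sum fun i hi => by exact_mod_cast (mem_lightRows.mp hi).le
  have h2 : ((lightRows T c M j).card : ℝ) ≤ m := by
    have := Finset.card_le_univ (lightRows T c M j)
    rw [Fintype.card_fin] at this
    exact_mod_cast this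
  rw [Finset.sum_const, nsmul_eq_mul] at h1
  have hM : (0 : ℝ) ≤ M := Nat.cast_nonneg M
  nlinarith

/-! ## 2. Union of the good-line bounds over all (curve, line) pairs -/

/-- **Row union bound**: the assignments overloading some light row of some curve of `T` weigh
at most `#T · m · exp(−t²/(2(2pmM + 2t/3)))`. [this file] -/
theorem weight_exists_rowOver_le {w : (Fin 3 → Fin (qOf m)) → Fin m → ℝ}
    (hw : ∀ c a, 0 ≤ w c a) (hw1 : ∀ c, ∑ a, w c a = 1) {p t : ℝ} (hp : 0 < p)
    (hwp : ∀ c', w c' ≤ fun _ => p) (T : Finset (Fin 3 → Fin (qOf m))) {M : ℕ} (hM : 0 < M)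
    (hm : 0 < m) (ht : 0 < t) :
    ∑ r ∈ (Finset.univ : Finset ((Fin 3 → Fin (qOf m)) → Fin m)).filter
        (fun r => ∃ c ∈ T, ∃ i : Fin m, p * ((m : ℝ) * M) + t ≤
          ∑ c', rowKillOn (lightCols T c M i) T c i c' (r c')), prodWeight w r
      ≤ (T.card : ℝ) * m * exp (-(t ^ 2 / (2 * (2 * (p * ((m : ℝ) * M)) + 2 * t / 3)))) := by
  classical
  set B : (Fin 3 → Fin (qOf m)) × Fin m → Finset ((Fin 3 → Fin (qOf m)) → Fin m) :=
    fun ci => Finset.univ.filter fun r => p * ((m : ℝ) * M) + t ≤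
      ∑ c', rowKillOn (lightCols T ci.1 M ci.2) T ci.1 ci.2 c' (r c') with hB
  have hsub : (Finset.univ : Finset ((Fin 3 → Fin (qOf m)) → Fin m)).filter
      (fun r => ∃ c ∈ T, ∃ i : Fin m, p * ((m : ℝ) * M) + t ≤
        ∑ c', rowKillOn (lightCols T c M i) T c i c' (r c')) ⊆
      (T ×ˢ (Finset.univ : Finset (Fin m))).biUnion B := by
    intro r hr
    obtain ⟨c, hc, i, hi⟩ := (Finset.mem_filter.mp hr).2
    exact Finset.mem_biUnion.mpr ⟨(c, i), Finset.mem_product.mpr ⟨hc, Finset.mem_univ _⟩,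
      Finset.mem_filter.mpr ⟨Finset.mem_univ _, hi⟩⟩
  have hpI : 0 < p * ((m : ℝ) * M) :=
    mul_pos hp (mul_pos (by exact_mod_cast hm) (by exact_mod_cast hM))
  have h3 : ∀ ci ∈ T ×ˢ (Finset.univ : Finset (Fin m)), ∑ r ∈ B ci, prodWeight w r ≤
      exp (-(t ^ 2 / (2 * (2 * (p * ((m : ℝ) * M)) + 2 * t / 3)))) := fun ci _ =>
    weight_rowLoadOn_le (lightCols T ci.1 M ci.2) hw hw1 hp.le hwp T ci.1 ci.2
      (sum_card_coCurves_lightCols_le T ci.1 M ci.2) hpI ht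
  calc _ ≤ ∑ r ∈ (T ×ˢ (Finset.univ : Finset (Fin m))).biUnion B, prodWeight w r :=
        Finset.sum_le_sum_of_subset_of_nonneg hsub fun r _ _ => prodWeight_nonneg hw r
    _ ≤ ∑ ci ∈ T ×ˢ (Finset.univ : Finset (Fin m)), ∑ r ∈ B ci, prodWeight w r :=
        weight_biUnion_le _ B hw
    _ ≤ ∑ ci ∈ T ×ˢ (Finset.univ : Finset (Fin m)),
          exp (-(t ^ 2 / (2 * (2 * (p * ((m : ℝ) * M)) + 2 * t / 3)))) := Finset.sum_le_sum h3
    _ = (T.card : ℝ) * m * exp (-(t ^ 2 / (2 * (2 * (p * ((m : ℝ) * M)) + 2 * t / 3)))) := by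
        rw [Finset.sum_const, Finset.card_product, Finset.card_univ, Fintype.card_fin,
          nsmul_eq_mul]
        push_cast
        ring

/-- **Column union bound**: the assignments overloading some light column of some curve of `T`
weigh at most `#T · m · exp(−t²/(2(pmM + t/3)))`. [this file] -/
theorem weight_exists_colOver_le {w : (Fin 3 → Fin (qOf m)) → Fin m → ℝ}
    (hw : ∀ c a, 0 ≤ w c a) (hw1 : ∀ c, ∑ a, w c a = 1) {p t : ℝ} (hp : 0 < p)
    (hwp : ∀ c', w c' ≤ fun _ => p) (T : Finset (Fin 3 → Fin (qOf m))) {M : ℕ} (hM : 0 < M)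
    (hm : 0 < m) (ht : 0 < t) :
    ∑ r ∈ (Finset.univ : Finset ((Fin 3 → Fin (qOf m)) → Fin m)).filter
        (fun r => ∃ c ∈ T, ∃ j : Fin m, p * ((m : ℝ) * M) + t ≤
          ∑ c', colKillOn (lightRows T c M j) T c j c' (r c')), prodWeight w r
      ≤ (T.card : ℝ) * m * exp (-(t ^ 2 / (2 * (p * ((m : ℝ) * M) + 1 * t / 3)))) := by
  classical
  set B : (Fin 3 → Fin (qOf m)) × Fin m → Finset ((Fin 3 → Fin (qOf m)) → Fin m) :=
    fun cj => Finset.univ.filter fun r => p * ((m : ℝ) * M) + t ≤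
      ∑ c', colKillOn (lightRows T cj.1 M cj.2) T cj.1 cj.2 c' (r c') with hB
  have hsub : (Finset.univ : Finset ((Fin 3 → Fin (qOf m)) → Fin m)).filter
      (fun r => ∃ c ∈ T, ∃ j : Fin m, p * ((m : ℝ) * M) + t ≤
        ∑ c', colKillOn (lightRows T c M j) T c j c' (r c')) ⊆
      (T ×ˢ (Finset.univ : Finset (Fin m))).biUnion B := by
    intro r hr
    obtain ⟨c, hc, j, hj⟩ := (Finset.mem_filter.mp hr).2
    exact Finset.mem_biUnion.mpr ⟨(c, j), Finset.mem_product.mpr ⟨hc, Finset.mem_univ _⟩,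
      Finset.mem_filter.mpr ⟨Finset.mem_univ _, hj⟩⟩
  have hpI : 0 < p * ((m : ℝ) * M) :=
    mul_pos hp (mul_pos (by exact_mod_cast hm) (by exact_mod_cast hM))
  have h3 : ∀ cj ∈ T ×ˢ (Finset.univ : Finset (Fin m)), ∑ r ∈ B cj, prodWeight w r ≤
      exp (-(t ^ 2 / (2 * (p * ((m : ℝ) * M) + 1 * t / 3)))) := fun cj _ =>
    weight_colLoadOn_le (lightRows T cj.1 M cj.2) hw hw1 hp.le hwp T cj.1 cj.2
      (sum_card_coCurves_lightRows_le T cj.1 M cj.2) hpI ht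
  calc _ ≤ ∑ r ∈ (T ×ˢ (Finset.univ : Finset (Fin m))).biUnion B, prodWeight w r :=
        Finset.sum_le_sum_of_subset_of_nonneg hsub fun r _ _ => prodWeight_nonneg hw r
    _ ≤ ∑ cj ∈ T ×ˢ (Finset.univ : Finset (Fin m)), ∑ r ∈ B cj, prodWeight w r :=
        weight_biUnion_le _ B hw
    _ ≤ ∑ cj ∈ T ×ˢ (Finset.univ : Finset (Fin m)),
          exp (-(t ^ 2 / (2 * (p * ((m : ℝ) * M) + 1 * t / 3)))) := Finset.sum_le_sum h3
    _ = (T.card : ℝ) * m * exp (-(t ^ 2 / (2 * (p * ((m : ℝ) * M) + 1 * t / 3)))) := by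
        rw [Finset.sum_const, Finset.card_product, Finset.card_univ, Fintype.card_fin,
          nsmul_eq_mul]
        push_cast
        ring

/-! ## 3. Off the overload events: few bad lines -/

/-- Off the row-overload events and within budget `2 (L + pmM + t) ≤ m`, every curve of `T` has
`M · L · #badRows ≤ 2 (#T − 1)` — for every pivot column `s₀`. [this file] -/
theorem mul_card_badRows_le_of_not_over (T : Finset (Fin 3 → Fin (qOf m))) (s₀ : Fin m)
    (r : (Fin 3 → Fin (qOf m)) → Fin m) (M L : ℕ) {p t : ℝ}
    (hr : ∀ c ∈ T, ∀ i : Fin m,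
      ∑ c', rowKillOn (lightCols T c M i) T c i c' (r c') < p * ((m : ℝ) * M) + t)
    (hbudget : 2 * ((L : ℝ) + (p * ((m : ℝ) * M) + t)) ≤ m) {c : Fin 3 → Fin (qOf m)}
    (hc : c ∈ T) :
    M * L * (badRows (pivotZeros m T s₀ r) c (r c) s₀).card ≤ 2 * (T.erase c).card :=
  mul_card_badRows_le T s₀ r c M L fun i _ _ => by
    have := hr c hc i
    linarith

/-- Off the column-overload events and within budget, every curve of `T` has
`M · L · #badCols ≤ 2 (#T − 1)` — for every pivot column `s₀`. [this file] -/
theorem mul_card_badCols_le_of_not_over (T : Finset (Fin 3 → Fin (qOf m))) (s₀ : Fin m)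
    (r : (Fin 3 → Fin (qOf m)) → Fin m) (M L : ℕ) {p t : ℝ}
    (hr : ∀ c ∈ T, ∀ j : Fin m,
      ∑ c', colKillOn (lightRows T c M j) T c j c' (r c') < p * ((m : ℝ) * M) + t)
    (hbudget : 2 * ((L : ℝ) + (p * ((m : ℝ) * M) + t)) ≤ m) {c : Fin 3 → Fin (qOf m)}
    (hc : c ∈ T) :
    M * L * (badCols (pivotZeros m T s₀ r) c (r c) s₀).card ≤ 2 * (T.erase c).card :=
  mul_card_badCols_le T s₀ r c M L fun j _ _ => by
    have := hr c hc j
    linarith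

/-! ## 4. Phase A for good lines: an admissible assignment with few bad lines exists -/

/-- **PHASE A (good lines).**  For admissible sets `A c` of at least `1/p` rows each, within the
budget `2 (L + pmM + t) ≤ m` and with the two union bounds summing to `< 1`, some admissible row
assignment leaves every curve of `T`, for every pivot column, with
`M · L · #badRows ≤ 2 (#T − 1)` and `M · L · #badCols ≤ 2 (#T − 1)`. [this file] -/
theorem exists_adm_fewBadLines (T : Finset (Fin 3 → Fin (qOf m)))
    (A : (Fin 3 → Fin (qOf m)) → Finset (Fin m)) (hA : ∀ c, (A c).Nonempty) {p t : ℝ}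
    (hp : 0 < p) (hAp : ∀ c, 1 / ((A c).card : ℝ) ≤ p) {M L : ℕ} (hM : 0 < M) (hm : 0 < m)
    (ht : 0 < t) (hbudget : 2 * ((L : ℝ) + (p * ((m : ℝ) * M) + t)) ≤ m)
    (hsmall : (T.card : ℝ) * m * exp (-(t ^ 2 / (2 * (2 * (p * ((m : ℝ) * M)) + 2 * t / 3))))
      + (T.card : ℝ) * m * exp (-(t ^ 2 / (2 * (p * ((m : ℝ) * M) + 1 * t / 3)))) < 1) :
    ∃ r : (Fin 3 → Fin (qOf m)) → Fin m, (∀ c, r c ∈ A c) ∧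
      ∀ s₀ : Fin m, ∀ c ∈ T,
        M * L * (badRows (pivotZeros m T s₀ r) c (r c) s₀).card ≤ 2 * (T.erase c).card ∧
        M * L * (badCols (pivotZeros m T s₀ r) c (r c) s₀).card ≤ 2 * (T.erase c).card := by
  classical
  set w := admWeight A with hw_def
  have hw : ∀ c a, 0 ≤ w c a := admWeight_nonneg A
  have hw1 : ∀ c, ∑ a, w c a = 1 := sum_admWeight A hA
  have hwp : ∀ c', w c' ≤ fun _ => p := fun c' a => (admWeight_le A c' a).trans (hAp c')
  set ER := (Finset.univ : Finset ((Fin 3 → Fin (qOf m)) → Fin m)).filter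
    (fun r => ∃ c ∈ T, ∃ i : Fin m, p * ((m : ℝ) * M) + t ≤
      ∑ c', rowKillOn (lightCols T c M i) T c i c' (r c')) with hER
  set EC := (Finset.univ : Finset ((Fin 3 → Fin (qOf m)) → Fin m)).filter
    (fun r => ∃ c ∈ T, ∃ j : Fin m, p * ((m : ℝ) * M) + t ≤
      ∑ c', colKillOn (lightRows T c M j) T c j c' (r c')) with hEC
  have hR := weight_exists_rowOver_le hw hw1 hp hwp T hM hm ht
  have hC := weight_exists_colOver_le hw hw1 hp hwp T hM hm ht
  have hunion : ∑ r ∈ ER ∪ EC, prodWeight w r ≤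
      ∑ r ∈ ER, prodWeight w r + ∑ r ∈ EC, prodWeight w r := by
    rw [← Finset.sum_union_inter]
    have : 0 ≤ ∑ r ∈ ER ∩ EC, prodWeight w r :=
      Finset.sum_nonneg fun r _ => prodWeight_nonneg hw r
    linarith
  have hlt : ∑ r ∈ ER ∪ EC, prodWeight (admWeight A) r < 1 := by
    have h := hunion
    rw [hw_def] at h hR hC
    linarith
  obtain ⟨r, hr, hadm⟩ := exists_adm_not_mem A hA (ER ∪ EC) hlt
  have hrR : ∀ c ∈ T, ∀ i : Fin m,
      ∑ c', rowKillOn (lightCols T c M i) T c i c' (r c') < p * ((m : ℝ) * M) + t := by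
    intro c hc i
    by_contra hge
    exact hr (Finset.mem_union_left _ (Finset.mem_filter.mpr
      ⟨Finset.mem_univ _, c, hc, i, not_lt.mp hge⟩))
  have hrC : ∀ c ∈ T, ∀ j : Fin m,
      ∑ c', colKillOn (lightRows T c M j) T c j c' (r c') < p * ((m : ℝ) * M) + t := by
    intro c hc j
    by_contra hge
    exact hr (Finset.mem_union_right _ (Finset.mem_filter.mpr
      ⟨Finset.mem_univ _, c, hc, j, not_lt.mp hge⟩))
  exact ⟨r, hadm, fun s₀ c hc =>
    ⟨mul_card_badRows_le_of_not_over T s₀ r M L hrR hbudget hc,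
      mul_card_badCols_le_of_not_over T s₀ r M L hrC hbudget hc⟩⟩

end Summit.ValiantsHypothesis.ValiantsHypothesis.Theorems.DefinabilityGapPivotGoodUnion
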